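import Mathlib
import Summits.CriticalPhenomena.SAWScalingLimit.Theorems.SAWDefectDecoherenceDefectDecoherenceSsSectorRowD
import HarnessLib

/-!
# The exact `U`- and `S`-rows of the sector system (helpers `ss_sectorRowU`, `ss_sectorRowS` of the
line `sector-slaving`, crux `DefectDecoherence`, stmt-CriticalPhenomena-8549)

At a `2`-deep vertex `v` of `Λ`, for an adjacent boundary root `a = s(u,w)` (`u ∉ Λ ∋ w`), the full
via-dart sums of the unstable and of the signal character satisfy
`Ā_U(v) = Σ_{t ∼ v} [(1/3) U(t) + (c_S/3) e(t) S(t) + (c_D/3) e(t)² D(t)]`,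
`Ā_S(v) = Σ_{t ∼ v} [(1/3) ē(t) U(t) + (c_S/3) S(t) + (c_D/3) e(t) D(t)]`,
`e(t) = dartUnit v t`, `U, S, D = A_{-3/8}, A_{5/8}, A_{13/8}` the clean arrival sums at `t`,
`c_S = 2x_c cos(5π/24)`, `c_D = 2x_c cos(13π/24)` (and `c_U = 2x_c cos(π/8) = 1`).  Together with the
landed `D`-row (`stub_sectorRowD`: `Ā_D(v) = rowD(v)`) these are the three rows
`Ā_{ξ_k'}(v) = Σ_k (c_k/3) Σ_{t ∼ v} e(t)^{k-k'} A_{ξ_k}(t)` (`e^{-m} := ē^m`) of the nearest-neighbour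
sector system.

Proof: verbatim the proof of the `D`-row (file `…SsSectorRowD.lean`).  ONE STEP: a via-`t` walk at
`mid{t,v}` (last vertex `t`) is a clean arrival `ω` at `t` through a dart `s → t`, `s ∈ star Λ t ∖ {v}`,
prolonged by `t` (`tip_sum_viaV` read at `t`); the prolongation adds the turn `τ(s) = ±π/3`
(`tip_winding_snoc`) and one factor `x_c`.  With `e^{iΘ(ω)} = d_s := dartUnit t s`
(`tip_exp_lifted_direction`) the three characters of `ω` are `e^{-i(13/8)Θ}·(d_s², d_s, 1)`; for
`s = v` (`d_s = -e`) the row brackets vanish (`rowD_coeff_zero`), for `s = ρv, ρ²v`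
(`d_s = e^{∓iπ/3} e`) they equal `x_c e^{-iξ'(Θ + τ(s))}` by `rowD_coeff_minus/plus` and the phase
bookkeeping `e^{-i(13/8)τ} = e^{∓2iπ/3} e^{-i(-3/8)τ} = e^{∓iπ/3} e^{-i(5/8)τ}` (`τ = ±π/3`).

Sources: H. Duminil-Copin, S. Smirnov, Ann. of Math. 175 (2012) (arXiv:1007.0575), §2 (windings, proof
of Lemma 1); the line card `Lines/sector-slaving.md` (rows verified by exact enumeration to `1e-16`).
-/

noncomputable section

open scoped BigOperators ComplexConjugate Classical
open Literature.Probability.LatticeModels Literature.Probability.RandomPlanarGeometry.SAW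
open Summit.CriticalPhenomena.SAWScalingLimit.Theorems.DefectDecoherence.TipMartingale
open Summit.CriticalPhenomena.SAWScalingLimit.Theorems.SpinShift

namespace Summit.CriticalPhenomena.SAWScalingLimit.Theorems.DefectDecoherence.SectorSlaving

/-! ### Phase bookkeeping for the turns `±π/3` -/

/-- `e^{-i(13/8)(π/3)} = (e^{-iπ/3})² · e^{-i(-3/8)(π/3)}`. [folklore] -/
theorem rowU_phase_pos :
    Complex.exp (-Complex.I * ((13 / 8 : ℝ) : ℂ) * ((Real.pi / 3 : ℝ) : ℂ)) =
      Complex.exp (((-(Real.pi / 3) : ℝ) : ℂ) * Complex.I) ^ 2 *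
        Complex.exp (-Complex.I * ((-3 / 8 : ℝ) : ℂ) * ((Real.pi / 3 : ℝ) : ℂ)) := by
  rw [sq, ← Complex.exp_add, ← Complex.exp_add]
  congr 1
  push_cast
  ring

/-- `e^{-i(13/8)(-π/3)} = (e^{iπ/3})² · e^{-i(-3/8)(-π/3)}`. [folklore] -/
theorem rowU_phase_neg :
    Complex.exp (-Complex.I * ((13 / 8 : ℝ) : ℂ) * ((-(Real.pi / 3) : ℝ) : ℂ)) =
      Complex.exp (((Real.pi / 3 : ℝ) : ℂ) * Complex.I) ^ 2 *
        Complex.exp (-Complex.I * ((-3 / 8 : ℝ) : ℂ) * ((-(Real.pi / 3) : ℝ) : ℂ)) := by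
  rw [sq, ← Complex.exp_add, ← Complex.exp_add]
  congr 1
  push_cast
  ring

/-- `e^{-i(13/8)(π/3)} = e^{-iπ/3} · e^{-i(5/8)(π/3)}`. [folklore] -/
theorem rowS_phase_pos :
    Complex.exp (-Complex.I * ((13 / 8 : ℝ) : ℂ) * ((Real.pi / 3 : ℝ) : ℂ)) =
      Complex.exp (((-(Real.pi / 3) : ℝ) : ℂ) * Complex.I) *
        Complex.exp (-Complex.I * ((5 / 8 : ℝ) : ℂ) * ((Real.pi / 3 : ℝ) : ℂ)) := by
  rw [← Complex.exp_add]
  congr 1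
  push_cast
  ring

/-- `e^{-i(13/8)(-π/3)} = e^{iπ/3} · e^{-i(5/8)(-π/3)}`. [folklore] -/
theorem rowS_phase_neg :
    Complex.exp (-Complex.I * ((13 / 8 : ℝ) : ℂ) * ((-(Real.pi / 3) : ℝ) : ℂ)) =
      Complex.exp (((Real.pi / 3 : ℝ) : ℂ) * Complex.I) *
        Complex.exp (-Complex.I * ((5 / 8 : ℝ) : ℂ) * ((-(Real.pi / 3) : ℝ) : ℂ)) := by
  rw [← Complex.exp_add]
  congr 1
  push_cast
  ring

/-! ### The `U`-row -/

/-- **Per-walk identity, `U`-row.**  For an arrival `ω : s(u,w) → s(s,t)` at `t ∼ v` through the dart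
`s → t` (last vertex `s`), the `U`-row combination of its three characters,
`(1/3) X_{-3/8}(ω) + c₁ e · X_{5/8}(ω) + c₂ e² · X_{13/8}(ω)` (`e = dartUnit v t`,
`X_ξ(ω) = x_c^{ℓ+1} e^{-iξΘ(ω)}`, `c₁ = 2x_c cos(5π/24)/3`, `c₂ = 2x_c cos(13π/24)/3`), vanishes for
the reversed dart `s = v` and equals the `U`-via-weight `x_c^{ℓ+2} e^{-i(-3/8)Θ(ω ++ [t])}` of the
prolonged walk `ω ++ [t] → mid{t,v}` for the two other darts. [folklore] -/
theorem rowU_term {Λ : Finset HexVertex} {u w v t s : HexVertex} (huw : hexGraph.Adj u w)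
    (hu : u ∉ Λ) (hvt : hexGraph.Adj v t) (hts : hexGraph.Adj t s)
    (ω : HexMidEdgeSAW Λ s(u, w) s(s, t)) (hlast : ω.verts.getLast? = some s) :
    (1 / 3 : ℂ) *
          ((xc : ℂ) ^ (ω.length + 1) *
            Complex.exp (-Complex.I * ((-3 / 8 : ℝ) : ℂ) * ((rootAngle u w + ω.winding : ℝ) : ℂ))) +
        ((2 * xc * Real.cos (5 * Real.pi / 24) / 3 : ℝ) : ℂ) * dartUnit v t *
          ((xc : ℂ) ^ (ω.length + 1) *
            Complex.exp (-Complex.I * ((5 / 8 : ℝ) : ℂ) * ((rootAngle u w + ω.winding : ℝ) : ℂ))) +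
      ((2 * xc * Real.cos (13 * Real.pi / 24) / 3 : ℝ) : ℂ) * dartUnit v t ^ 2 *
        ((xc : ℂ) ^ (ω.length + 1) *
          Complex.exp (-Complex.I * ((13 / 8 : ℝ) : ℂ) * ((rootAngle u w + ω.winding : ℝ) : ℂ))) =
    if s = v then 0 else
      (xc : ℂ) ^ ((ω.verts ++ [t]).length + 1) *
        Complex.exp (-Complex.I * ((-3 / 8 : ℝ) : ℂ) *
          ((rootAngle u w + winding (hexMidpoint s(u, w) :: (ω.verts ++ [t]).map hexCenter ++
            [hexMidpoint s(v, t)]) : ℝ) : ℂ)) := by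
  -- the lifted direction of the arrival dart `s → t`
  have hd := tip_exp_lifted_direction huw hu hts.symm ω hlast
  set e := dartUnit v t with he
  set Θ : ℝ := rootAngle u w + ω.winding with hΘ
  set E := Complex.exp (-Complex.I * ((13 / 8 : ℝ) : ℂ) * (Θ : ℂ)) with hE
  have hU : Complex.exp (-Complex.I * ((-3 / 8 : ℝ) : ℂ) * (Θ : ℂ)) =
      E * Complex.exp ((Θ : ℂ) * Complex.I) ^ 2 := by
    rw [hE, sq, ← Complex.exp_add, ← Complex.exp_add]
    congr 1
    push_cast
    ring
  have hS : Complex.exp (-Complex.I * ((5 / 8 : ℝ) : ℂ) * (Θ : ℂ)) =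
      E * Complex.exp ((Θ : ℂ) * Complex.I) := by
    rw [hE, ← Complex.exp_add]
    congr 1
    push_cast
    ring
  have hsplit : ∀ τ : ℝ, Complex.exp (-Complex.I * ((-3 / 8 : ℝ) : ℂ) *
      ((rootAngle u w + (ω.winding + τ) : ℝ) : ℂ)) =
      E * Complex.exp ((Θ : ℂ) * Complex.I) ^ 2 *
        Complex.exp (-Complex.I * ((-3 / 8 : ℝ) : ℂ) * (τ : ℂ)) := by
    intro τ
    rw [hE, hΘ, sq, ← Complex.exp_add, ← Complex.exp_add, ← Complex.exp_add]
    congr 1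
    push_cast
    ring
  rw [hU, hS, hd]
  -- the walk prolonged by `t`
  obtain ⟨L, hL⟩ : ∃ L, ω.verts = L ++ [s] := ⟨_, (List.dropLast_append_getLast? s hlast).symm⟩
  have hW : ω.winding = winding (hexMidpoint s(u, w) :: (L ++ [s]).map hexCenter ++
      [hexMidpoint s(s, t)]) := by
    rw [HexMidEdgeSAW.winding, HexMidEdgeSAW.points, hL]
  have hlen : (L ++ [s] ++ [t]).length = ω.length + 1 := by
    rw [HexMidEdgeSAW.length, hL]; simp
  rw [hL, tip_winding_snoc, ← hW, hlen]
  -- the three darts at `t`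
  rcases (tip_adj_iff hvt.symm s).1 hts with h | h | h
  · -- the reversed dart `v → t`
    have hds : dartUnit t s = -e := by rw [h, he]; exact rowD_dartUnit_swap v t
    rw [if_pos h, hds]
    linear_combination ((xc : ℂ) ^ (ω.length + 1) * E * e ^ 2) * rowD_coeff_zero
  · -- the dart `ρv → t`: turn `+π/3`
    have hne : s ≠ v := by rw [h]; exact (tip_rot3_ne hvt.symm).1.symm
    have hds : dartUnit t s = Complex.exp (((-(Real.pi / 3) : ℝ) : ℂ) * Complex.I) * e := by
      rw [h, he]; exact rowD_dartUnit_rot3 v t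
    have hτ : turning (hexCenter s) (hexCenter t) (hexMidpoint s(v, t)) = Real.pi / 3 := by
      rw [h]; exact rowD_turning_rot3 hvt
    rw [if_neg hne, hτ, hsplit, hd, hds]
    linear_combination ((xc : ℂ) ^ (ω.length + 1) * E * e ^ 2) * rowD_coeff_minus +
      ((xc : ℂ) ^ (ω.length + 1) * E * e ^ 2 * (xc : ℂ)) * rowU_phase_pos
  · -- the dart `ρ²v → t`: turn `-π/3`
    have hne : s ≠ v := by rw [h]; exact (tip_rot3_ne hvt.symm).2.1.symm
    have hds : dartUnit t s = Complex.exp (((Real.pi / 3 : ℝ) : ℂ) * Complex.I) * e := by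
      rw [h, he]; exact rowD_dartUnit_rot3_rot3 v t
    have hτ : turning (hexCenter s) (hexCenter t) (hexMidpoint s(v, t)) = -(Real.pi / 3) := by
      rw [h]; exact rowD_turning_rot3_rot3 hvt
    rw [if_neg hne, hτ, hsplit, hd, hds]
    linear_combination ((xc : ℂ) ^ (ω.length + 1) * E * e ^ 2) * rowD_coeff_plus +
      ((xc : ℂ) ^ (ω.length + 1) * E * e ^ 2 * (xc : ℂ)) * rowU_phase_neg

/-- **The exact `U`-row** (registered helper `ss_sectorRowU` of the line `sector-slaving`): at a
`2`-deep vertex `v`,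
`Ā_U(v) = Σ_{t ∼ v} [(1/3) U(t) + (2x_c cos(5π/24)/3) e(t) S(t) + (2x_c cos(13π/24)/3) e(t)² D(t)]`.
[folklore] -/
theorem ss_sectorRowU :
    ∀ (Λ : Finset HexVertex) (u w : HexVertex), hexGraph.Adj u w → u ∉ Λ → w ∈ Λ →
      ∀ v : HexVertex, Deep Λ v 2 →
        viaSum Λ s(u, w) (rootAngle u w) (-3 / 8) v =
          ∑ t ∈ star Λ v,
            ((1 / 3 : ℂ) * arrivalSum Λ s(u, w) (rootAngle u w) (-3 / 8) t +
                ((2 * xc * Real.cos (5 * Real.pi / 24) / 3 : ℝ) : ℂ) * dartUnit v t *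
                  arrivalSum Λ s(u, w) (rootAngle u w) (5 / 8) t +
              ((2 * xc * Real.cos (13 * Real.pi / 24) / 3 : ℝ) : ℂ) * dartUnit v t ^ 2 *
                arrivalSum Λ s(u, w) (rootAngle u w) (13 / 8) t) := by
  intro Λ u w huw hu _ v hdeep
  have hv : v ∈ Λ := hdeep v (by simp)
  unfold viaSum
  refine Finset.sum_congr rfl fun t ht => ?_
  obtain ⟨htΛ, hvt⟩ := tip_mem_star.1 ht
  -- `u` is far from `v`, so the root vertex `w` is not the neighbour `t`
  have hwt : w ≠ t := by
    rintro rfl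
    refine hu (hdeep u ?_)
    linarith [dist_triangle (hexCenter u) (hexCenter w) (hexCenter v),
      dist_hexCenter_le_one_of_adj huw, dist_hexCenter_le_one_of_adj hvt.symm]
  have hv' : v ∈ star Λ t := tip_mem_star.2 ⟨hv, hvt.symm⟩
  -- via-`t` walks at `mid{t,v}` = clean arrivals at `t` through `s → t`, `s ≠ v`, prolonged by `t`
  rw [Sym2.eq_swap (a := t) (b := v)]
  refine (tip_sum_viaV hu htΛ hwt hv' (fun l => (xc : ℂ) ^ (l.length + 1) *
    Complex.exp (-Complex.I * ((-3 / 8 : ℝ) : ℂ) * ((rootAngle u w +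
      winding (hexMidpoint s(u, w) :: l.map hexCenter ++ [hexMidpoint s(v, t)]) : ℝ) : ℂ)))).trans ?_
  -- distribute the row over the arrivals at `t`
  unfold arrivalSum
  simp only [Finset.mul_sum, ← Finset.sum_add_distrib]
  refine Finset.sum_congr rfl fun s hs => Finset.sum_congr rfl fun ω _ => ?_
  obtain ⟨-, hts⟩ := tip_mem_star.1 hs
  by_cases hc : ω.verts.getLast? = some s ∧ t ∉ ω.verts
  · simp only [if_pos hc]
    exact (rowU_term huw hu hvt hts ω hc.1).symm
  · simp only [if_neg hc, mul_zero, add_zero]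

/-! ### The `S`-row -/

/-- **Per-walk identity, `S`-row.**  For an arrival `ω : s(u,w) → s(s,t)` at `t ∼ v` through the dart
`s → t` (last vertex `s`), the `S`-row combination of its three characters,
`(1/3) ē · X_{-3/8}(ω) + c₁ · X_{5/8}(ω) + c₂ e · X_{13/8}(ω)` (`e = dartUnit v t`), vanishes for the
reversed dart `s = v` and equals the `S`-via-weight `x_c^{ℓ+2} e^{-i(5/8)Θ(ω ++ [t])}` of the
prolonged walk for the two other darts. [folklore] -/
theorem rowS_term {Λ : Finset HexVertex} {u w v t s : HexVertex} (huw : hexGraph.Adj u w)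
    (hu : u ∉ Λ) (hvt : hexGraph.Adj v t) (hts : hexGraph.Adj t s)
    (ω : HexMidEdgeSAW Λ s(u, w) s(s, t)) (hlast : ω.verts.getLast? = some s) :
    (1 / 3 : ℂ) * starRingEnd ℂ (dartUnit v t) *
          ((xc : ℂ) ^ (ω.length + 1) *
            Complex.exp (-Complex.I * ((-3 / 8 : ℝ) : ℂ) * ((rootAngle u w + ω.winding : ℝ) : ℂ))) +
        ((2 * xc * Real.cos (5 * Real.pi / 24) / 3 : ℝ) : ℂ) *
          ((xc : ℂ) ^ (ω.length + 1) *
            Complex.exp (-Complex.I * ((5 / 8 : ℝ) : ℂ) * ((rootAngle u w + ω.winding : ℝ) : ℂ))) +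
      ((2 * xc * Real.cos (13 * Real.pi / 24) / 3 : ℝ) : ℂ) * dartUnit v t *
        ((xc : ℂ) ^ (ω.length + 1) *
          Complex.exp (-Complex.I * ((13 / 8 : ℝ) : ℂ) * ((rootAngle u w + ω.winding : ℝ) : ℂ))) =
    if s = v then 0 else
      (xc : ℂ) ^ ((ω.verts ++ [t]).length + 1) *
        Complex.exp (-Complex.I * ((5 / 8 : ℝ) : ℂ) *
          ((rootAngle u w + winding (hexMidpoint s(u, w) :: (ω.verts ++ [t]).map hexCenter ++
            [hexMidpoint s(v, t)]) : ℝ) : ℂ)) := by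
  -- the lifted direction of the arrival dart `s → t`
  have hd := tip_exp_lifted_direction huw hu hts.symm ω hlast
  have h1 := rowD_conj_dartUnit_mul hvt
  set e := dartUnit v t with he
  set Θ : ℝ := rootAngle u w + ω.winding with hΘ
  set E := Complex.exp (-Complex.I * ((13 / 8 : ℝ) : ℂ) * (Θ : ℂ)) with hE
  have hU : Complex.exp (-Complex.I * ((-3 / 8 : ℝ) : ℂ) * (Θ : ℂ)) =
      E * Complex.exp ((Θ : ℂ) * Complex.I) ^ 2 := by
    rw [hE, sq, ← Complex.exp_add, ← Complex.exp_add]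
    congr 1
    push_cast
    ring
  have hS : Complex.exp (-Complex.I * ((5 / 8 : ℝ) : ℂ) * (Θ : ℂ)) =
      E * Complex.exp ((Θ : ℂ) * Complex.I) := by
    rw [hE, ← Complex.exp_add]
    congr 1
    push_cast
    ring
  have hsplit : ∀ τ : ℝ, Complex.exp (-Complex.I * ((5 / 8 : ℝ) : ℂ) *
      ((rootAngle u w + (ω.winding + τ) : ℝ) : ℂ)) =
      E * Complex.exp ((Θ : ℂ) * Complex.I) *
        Complex.exp (-Complex.I * ((5 / 8 : ℝ) : ℂ) * (τ : ℂ)) := by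
    intro τ
    rw [hE, hΘ, ← Complex.exp_add, ← Complex.exp_add]
    congr 1
    push_cast
    ring
  rw [hU, hS, hd]
  -- the walk prolonged by `t`
  obtain ⟨L, hL⟩ : ∃ L, ω.verts = L ++ [s] := ⟨_, (List.dropLast_append_getLast? s hlast).symm⟩
  have hW : ω.winding = winding (hexMidpoint s(u, w) :: (L ++ [s]).map hexCenter ++
      [hexMidpoint s(s, t)]) := by
    rw [HexMidEdgeSAW.winding, HexMidEdgeSAW.points, hL]
  have hlen : (L ++ [s] ++ [t]).length = ω.length + 1 := by
    rw [HexMidEdgeSAW.length, hL]; simp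
  rw [hL, tip_winding_snoc, ← hW, hlen]
  -- the three darts at `t`
  rcases (tip_adj_iff hvt.symm s).1 hts with h | h | h
  · -- the reversed dart `v → t`
    have hds : dartUnit t s = -e := by rw [h, he]; exact rowD_dartUnit_swap v t
    rw [if_pos h, hds]
    linear_combination ((xc : ℂ) ^ (ω.length + 1) * E * e * (1 / 3 : ℂ)) * h1 +
      ((xc : ℂ) ^ (ω.length + 1) * E * e) * rowD_coeff_zero
  · -- the dart `ρv → t`: turn `+π/3`
    have hne : s ≠ v := by rw [h]; exact (tip_rot3_ne hvt.symm).1.symm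
    have hds : dartUnit t s = Complex.exp (((-(Real.pi / 3) : ℝ) : ℂ) * Complex.I) * e := by
      rw [h, he]; exact rowD_dartUnit_rot3 v t
    have hτ : turning (hexCenter s) (hexCenter t) (hexMidpoint s(v, t)) = Real.pi / 3 := by
      rw [h]; exact rowD_turning_rot3 hvt
    rw [if_neg hne, hτ, hsplit, hd, hds]
    linear_combination ((xc : ℂ) ^ (ω.length + 1) * E * e * (1 / 3 : ℂ) *
        Complex.exp (((-(Real.pi / 3) : ℝ) : ℂ) * Complex.I) ^ 2) * h1 +
      ((xc : ℂ) ^ (ω.length + 1) * E * e) * rowD_coeff_minus +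
      ((xc : ℂ) ^ (ω.length + 1) * E * e * (xc : ℂ)) * rowS_phase_pos
  · -- the dart `ρ²v → t`: turn `-π/3`
    have hne : s ≠ v := by rw [h]; exact (tip_rot3_ne hvt.symm).2.1.symm
    have hds : dartUnit t s = Complex.exp (((Real.pi / 3 : ℝ) : ℂ) * Complex.I) * e := by
      rw [h, he]; exact rowD_dartUnit_rot3_rot3 v t
    have hτ : turning (hexCenter s) (hexCenter t) (hexMidpoint s(v, t)) = -(Real.pi / 3) := by
      rw [h]; exact rowD_turning_rot3_rot3 hvt
    rw [if_neg hne, hτ, hsplit, hd, hds]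
    linear_combination ((xc : ℂ) ^ (ω.length + 1) * E * e * (1 / 3 : ℂ) *
        Complex.exp (((Real.pi / 3 : ℝ) : ℂ) * Complex.I) ^ 2) * h1 +
      ((xc : ℂ) ^ (ω.length + 1) * E * e) * rowD_coeff_plus +
      ((xc : ℂ) ^ (ω.length + 1) * E * e * (xc : ℂ)) * rowS_phase_neg

/-- **The exact `S`-row** (registered helper `ss_sectorRowS` of the line `sector-slaving`): at a
`2`-deep vertex `v`,
`Ā_S(v) = Σ_{t ∼ v} [(1/3) ē(t) U(t) + (2x_c cos(5π/24)/3) S(t) + (2x_c cos(13π/24)/3) e(t) D(t)]`.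
[folklore] -/
theorem ss_sectorRowS :
    ∀ (Λ : Finset HexVertex) (u w : HexVertex), hexGraph.Adj u w → u ∉ Λ → w ∈ Λ →
      ∀ v : HexVertex, Deep Λ v 2 →
        viaSum Λ s(u, w) (rootAngle u w) (5 / 8) v =
          ∑ t ∈ star Λ v,
            ((1 / 3 : ℂ) * starRingEnd ℂ (dartUnit v t) *
                  arrivalSum Λ s(u, w) (rootAngle u w) (-3 / 8) t +
                ((2 * xc * Real.cos (5 * Real.pi / 24) / 3 : ℝ) : ℂ) *
                  arrivalSum Λ s(u, w) (rootAngle u w) (5 / 8) t +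
              ((2 * xc * Real.cos (13 * Real.pi / 24) / 3 : ℝ) : ℂ) * dartUnit v t *
                arrivalSum Λ s(u, w) (rootAngle u w) (13 / 8) t) := by
  intro Λ u w huw hu _ v hdeep
  have hv : v ∈ Λ := hdeep v (by simp)
  unfold viaSum
  refine Finset.sum_congr rfl fun t ht => ?_
  obtain ⟨htΛ, hvt⟩ := tip_mem_star.1 ht
  -- `u` is far from `v`, so the root vertex `w` is not the neighbour `t`
  have hwt : w ≠ t := by
    rintro rfl
    refine hu (hdeep u ?_)
    linarith [dist_triangle (hexCenter u) (hexCenter w) (hexCenter v),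
      dist_hexCenter_le_one_of_adj huw, dist_hexCenter_le_one_of_adj hvt.symm]
  have hv' : v ∈ star Λ t := tip_mem_star.2 ⟨hv, hvt.symm⟩
  -- via-`t` walks at `mid{t,v}` = clean arrivals at `t` through `s → t`, `s ≠ v`, prolonged by `t`
  rw [Sym2.eq_swap (a := t) (b := v)]
  refine (tip_sum_viaV hu htΛ hwt hv' (fun l => (xc : ℂ) ^ (l.length + 1) *
    Complex.exp (-Complex.I * ((5 / 8 : ℝ) : ℂ) * ((rootAngle u w +
      winding (hexMidpoint s(u, w) :: l.map hexCenter ++ [hexMidpoint s(v, t)]) : ℝ) : ℂ)))).trans ?_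
  -- distribute the row over the arrivals at `t`
  unfold arrivalSum
  simp only [Finset.mul_sum, ← Finset.sum_add_distrib]
  refine Finset.sum_congr rfl fun s hs => Finset.sum_congr rfl fun ω _ => ?_
  obtain ⟨-, hts⟩ := tip_mem_star.1 hs
  by_cases hc : ω.verts.getLast? = some s ∧ t ∉ ω.verts
  · simp only [if_pos hc]
    exact (rowS_term huw hu hvt hts ω hc.1).symm
  · simp only [if_neg hc, mul_zero, add_zero]

end Summit.CriticalPhenomena.SAWScalingLimit.Theorems.DefectDecoherence.SectorSlaving

end
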